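import Mathlib
import Summits.Ventures.PercRepro2.ZMeanProof

/-!
# Deleting the edges of weight `0`: the mean field and (HMF) on the kept edges (blind cell
PercRepro2, night-1 g9; NIGHT1-G9.md §5 — the subtype companion of ZeroEdge)

Keep the edges satisfying a predicate `keep` and suppose every other edge has weight `0`.  The
configurations with an unkept edge open have weight `0` (`weight_eq_zero_of_open`), the others are
the extensions by `false` of the configurations of the kept edges with the same weight
(`weight_ext`), and the open graphs agree (`conn_ext`).  Hence every probability of a connection
event, the residual shares, the rows of `X̂` and **`HMFc`** transport (`prob_ext`, `HMFc_ext`,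
`HMF_ext_iff`).  Use: a star hypothesis «every edge at `a₃` is one of the coins **or has weight
`0`**» reduces to the strict one on the kept edges (`ZeroEdges.keep` with the coins kept).
-/

namespace Summit.Ventures.PercRepro2

open UnionCluster CovForm

namespace ZeroEdges

section Defs

variable {V : Type*} {E : Type*} (keep : E → Prop) [DecidablePred keep]

/-- The graph on the kept edges. -/
def endsR (ends : E → Sym2 V) : {e // keep e} → Sym2 V := fun e => ends e.1

/-- The weights on the kept edges. -/
def pR {R : Type*} (p : E → R) : {e // keep e} → R := fun e => p e.1

/-- A configuration of the kept edges extended by `false` on the others. -/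
def ext (ω : Config {e // keep e}) : Config E := fun e => if h : keep e then ω ⟨e, h⟩ else false

/-- The restriction of a configuration to the kept edges. -/
def res (ω : Config E) : Config {e // keep e} := fun e => ω e.1

variable {keep}

/-- The extension on a kept edge. -/
lemma ext_of_keep (ω : Config {e // keep e}) {e : E} (h : keep e) : ext keep ω e = ω ⟨e, h⟩ := by
  simp [ext, h]

/-- The extension on an unkept edge. -/
lemma ext_of_not_keep (ω : Config {e // keep e}) {e : E} (h : ¬ keep e) : ext keep ω e = false := by
  simp [ext, h]

/-- The restriction of the extension. -/
lemma res_ext (ω : Config {e // keep e}) : res keep (ext keep ω) = ω := by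
  funext e
  simp [res, ext, e.2]

/-- The extension of the restriction of a configuration closed off the kept edges. -/
lemma ext_res (ω : Config E) (h : ∀ e, ¬ keep e → ω e = false) : ext keep (res keep ω) = ω := by
  funext e
  by_cases he : keep e
  · simp [ext, res, he]
  · simp [ext, he, h e he]

/-- The open adjacencies of the extension are those of the kept configuration. -/
lemma openAdj_ext (ends : E → Sym2 V) (ω : Config {e // keep e}) (u v : V) :
    OpenAdj ends (ext keep ω) u v ↔ OpenAdj (endsR keep ends) ω u v := by
  constructor
  · rintro ⟨e, he, h⟩
    by_cases hk : keep e
    · exact ⟨⟨e, hk⟩, by rw [ext_of_keep ω hk] at he; exact he, h⟩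
    · rw [ext_of_not_keep ω hk] at he; exact absurd he Bool.false_ne_true
  · rintro ⟨e, he, h⟩
    exact ⟨e.1, by rw [ext_of_keep ω e.2]; exact he, h⟩

/-- The open graph of the extension is that of the kept configuration. -/
lemma openGraph_ext (ends : E → Sym2 V) (ω : Config {e // keep e}) :
    openGraph ends (ext keep ω) = openGraph (endsR keep ends) ω := by
  ext u v
  rw [openGraph_adj, openGraph_adj, openAdj_ext]

/-- **Connections transport.** -/
lemma conn_ext (ends : E → Sym2 V) (ω : Config {e // keep e}) (u v : V) :
    Conn ends (ext keep ω) u v ↔ Conn (endsR keep ends) ω u v := by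
  unfold Conn
  rw [openGraph_ext]

/-- Clusters transport. -/
lemma cluster_ext (ends : E → Sym2 V) (ω : Config {e // keep e}) (v : V) :
    cluster ends (ext keep ω) v = cluster (endsR keep ends) ω v := by
  ext u
  simp only [mem_cluster, conn_ext]

/-- The restriction to the edges not touching `W` commutes with the extension. -/
lemma restrict_ext [Fintype V] [DecidableEq V] (ends : E → Sym2 V) (W : Finset V)
    (ω : Config {e // keep e}) :
    restrict (touches ends (↑W : Set V))ᶜ (ext keep ω) =
      ext keep (restrict (touches (endsR keep ends) (↑W : Set V))ᶜ ω) := by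
  funext e
  by_cases hk : keep e
  · have h : e ∈ (touches ends (↑W : Set V))ᶜ ↔
        (⟨e, hk⟩ : {e // keep e}) ∈ (touches (endsR keep ends) (↑W : Set V))ᶜ := by
      simp only [Set.mem_compl_iff, touches, Set.mem_setOf_eq, endsR]
    by_cases he : e ∈ (touches ends (↑W : Set V))ᶜ
    · rw [restrict_apply_of_mem he, ext_of_keep _ hk, ext_of_keep _ hk,
        restrict_apply_of_mem (h.1 he)]
    · rw [restrict_apply_of_notMem he, ext_of_keep _ hk, restrict_apply_of_notMem (fun h' => he (h.2 h'))]
  · rw [ext_of_not_keep _ hk]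
    by_cases he : e ∈ (touches ends (↑W : Set V))ᶜ
    · rw [restrict_apply_of_mem he, ext_of_not_keep _ hk]
    · rw [restrict_apply_of_notMem he]

end Defs

section Prob

variable {V : Type*} {E : Type*} [Fintype E] [DecidableEq E] {R : Type*} [CommRing R]
  {keep : E → Prop} [DecidablePred keep]

omit [DecidableEq E] in
/-- The weight of the extension is the weight of the kept configuration (the unkept edges are
closed and have weight `0`, factor `1` each). -/
lemma weight_ext (p : E → R) (h0 : ∀ e, ¬ keep e → p e = 0) (ω : Config {e // keep e}) :
    weight p (ext keep ω) = weight (pR keep p) ω := by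
  unfold weight
  rw [← Fintype.prod_subtype_mul_prod_subtype keep]
  have h1 : ∏ e : {e // ¬ keep e}, edgeFactor (p e.1) (ext keep ω e.1) = 1 := by
    refine Finset.prod_eq_one fun e _ => ?_
    rw [ext_of_not_keep ω e.2, h0 e.1 e.2]
    simp [edgeFactor]
  rw [h1, mul_one]
  refine Finset.prod_congr rfl fun e _ => ?_
  rw [ext_of_keep ω e.2]
  rfl

omit [DecidablePred keep] in
/-- A configuration with an unkept edge open has weight `0`. -/
lemma weight_eq_zero_of_open (p : E → R) (h0 : ∀ e, ¬ keep e → p e = 0) (ω : Config E) {e : E}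
    (hk : ¬ keep e) (he : ω e = true) : weight p ω = 0 := by
  rw [weight_eq_mul_edgeFactor p ω e, he, h0 e hk]
  simp [edgeFactor]

/-- **Probabilities transport**: `P_p(A) = P_{pR p}(ext ⁻¹' A)`. -/
theorem prob_ext (p : E → R) (h0 : ∀ e, ¬ keep e → p e = 0) (A : Set (Config E)) :
    prob p A = prob (pR keep p) (ext keep ⁻¹' A) := by
  classical
  unfold prob
  rw [← Finset.sum_filter_add_sum_filter_not Finset.univ
    (fun ω : Config E => ∀ e, ¬ keep e → ω e = false)]
  have hz : ∑ ω ∈ Finset.univ.filter (fun ω : Config E => ¬ ∀ e, ¬ keep e → ω e = false),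
      A.indicator (weight p) ω = 0 := by
    refine Finset.sum_eq_zero fun ω hω => ?_
    have h := (Finset.mem_filter.1 hω).2
    push Not at h
    obtain ⟨e, hk, he⟩ := h
    have he' : ω e = true := by
      cases hh : ω e
      · exact absurd hh he
      · rfl
    rw [Set.indicator_apply]
    split_ifs
    · exact weight_eq_zero_of_open p h0 ω hk he'
    · rfl
  rw [hz, add_zero]
  refine Finset.sum_nbij' (res keep) (ext keep) ?_ ?_ ?_ ?_ ?_
  · intro ω _; exact Finset.mem_univ _
  · intro ω _
    simp only [Finset.mem_filter, Finset.mem_univ, true_and]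
    intro e hk
    exact ext_of_not_keep ω hk
  · intro ω hω
    exact ext_res ω (Finset.mem_filter.1 hω).2
  · intro ω _
    exact res_ext ω
  · intro ω hω
    have h := (Finset.mem_filter.1 hω).2
    rw [Set.indicator_apply, Set.indicator_apply, Set.mem_preimage, ext_res ω h]
    have hw : weight p ω = weight (pR keep p) (res keep ω) := by
      conv_lhs => rw [← ext_res ω h]
      exact weight_ext p h0 _
    rw [hw]

omit [Fintype E] [DecidableEq E] [DecidablePred keep] in
/-- The kept weights form a probability vector. -/
lemma isProbVec_pR [LinearOrder R] [IsStrictOrderedRing R] {p : E → R} (hp : IsProbVec p) :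
    IsProbVec (pR keep p) :=
  ⟨fun e => hp.nonneg e.1, fun e => hp.le_one e.1⟩

end Prob

section Events

variable {V : Type*} {E : Type*} {keep : E → Prop} [DecidablePred keep]

variable (ends : E → Sym2 V)

/-- Connection events transport. -/
lemma preimage_connEvent (u v : V) :
    ext keep ⁻¹' connEvent ends u v = connEvent (endsR keep ends) u v := by
  ext ω; simp only [Set.mem_preimage, mem_connEvent, conn_ext]

/-- Avoidance events transport. -/
lemma preimage_avoidAll (s : V) (X : Finset V) :
    ext keep ⁻¹' avoidAll ends s X = avoidAll (endsR keep ends) s X := by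
  ext ω; simp only [Set.mem_preimage, avoidAll, Set.mem_setOf_eq, conn_ext]

/-- Cluster events transport. -/
lemma preimage_clusterEvent (v : V) (S : Set V) :
    ext keep ⁻¹' clusterEvent ends v S = clusterEvent (endsR keep ends) v S := by
  ext ω; simp only [Set.mem_preimage, mem_clusterEvent, cluster_ext]

/-- `PD` transports. -/
lemma preimage_PDEvent (a₁ a₂ a₃ : V) :
    ext keep ⁻¹' PDEvent ends a₁ a₂ a₃ = PDEvent (endsR keep ends) a₁ a₂ a₃ := by
  ext ω
  simp only [Set.mem_preimage, PDEvent, Dtilde, UnionCluster.inU, Set.mem_inter_iff,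
    Set.mem_compl_iff, Set.mem_union, mem_connEvent, conn_ext]

/-- `T` transports. -/
lemma preimage_TEvent (a₁ a₂ a₃ : V) :
    ext keep ⁻¹' TEvent ends a₁ a₂ a₃ = TEvent (endsR keep ends) a₁ a₂ a₃ := by
  ext ω
  simp only [Set.mem_preimage, TEvent, Set.mem_inter_iff, Set.mem_compl_iff, mem_connEvent, conn_ext]

end Events

section EventsDel

variable {V : Type*} {E : Type*} [Fintype V] [DecidableEq V] {keep : E → Prop} [DecidablePred keep]

variable (ends : E → Sym2 V)

/-- Residual connection events transport. -/
lemma preimage_connDelEvent (W : Finset V) (u w : V) :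
    ext keep ⁻¹' connDelEvent ends W u w = connDelEvent (endsR keep ends) W u w := by
  ext ω
  simp only [Set.mem_preimage, connDelEvent, Set.mem_setOf_eq, restrict_ext, conn_ext]

/-- The residual `Q` transports. -/
lemma preimage_delQ (W : Finset V) (a₁ a₂ : V) :
    ext keep ⁻¹' delQ ends W a₁ a₂ = delQ (endsR keep ends) W a₁ a₂ := by
  unfold delQ
  rw [Set.preimage_compl, preimage_connDelEvent]

end EventsDel

section HMF

variable {V : Type*} {E : Type*} [Fintype E] [DecidableEq E] [Fintype V] [DecidableEq V]
  {R : Type*} [Field R] [LinearOrder R] [IsStrictOrderedRing R] {keep : E → Prop} [DecidablePred keep]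

variable (p : E → R) (ends : E → Sym2 V) (h0 : ∀ e, ¬ keep e → p e = 0)
include h0

omit [LinearOrder R] [IsStrictOrderedRing R] in
/-- Residual connection probabilities transport. -/
lemma delConnProb_ext (W : Finset V) (x v : V) :
    delConnProb p ends W x v = delConnProb (pR keep p) (endsR keep ends) W x v := by
  unfold delConnProb
  rw [prob_ext p h0, preimage_connDelEvent]

omit [LinearOrder R] [IsStrictOrderedRing R] in
/-- Residual shares transport. -/
lemma delShareMass_ext (W : Finset V) (a₁ a₂ x v : V) :
    delShareMass p ends W a₁ a₂ x v = delShareMass (pR keep p) (endsR keep ends) W a₁ a₂ x v := by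
  unfold delShareMass
  rw [prob_ext p h0, Set.preimage_inter, preimage_delQ, preimage_connDelEvent]

omit [LinearOrder R] [IsStrictOrderedRing R] in
/-- The rows of `X̂` transport. -/
lemma termW_ext (o a₁ a₂ b : V) (W : Finset V) :
    termW p ends o a₁ a₂ b W = termW (pR keep p) (endsR keep ends) o a₁ a₂ b W := by
  unfold termW termT termPD
  simp only [delConnProb_ext p ends h0, delShareMass_ext p ends h0, prob_ext p h0, preimage_delQ]

omit [LinearOrder R] [IsStrictOrderedRing R] in
/-- The mean field `X̂` transports. -/
lemma Xhat_ext (o a₁ a₂ a₃ b : V) :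
    Xhat p ends o a₁ a₂ a₃ b = Xhat (pR keep p) (endsR keep ends) o a₁ a₂ a₃ b := by
  rw [Xhat_eq_sum, Xhat_eq_sum]
  refine Finset.sum_congr rfl fun W _ => ?_
  rw [prob_ext p h0, preimage_clusterEvent, termW_ext p ends h0]

omit [LinearOrder R] [IsStrictOrderedRing R] in
/-- **The cleared mean field does not see the edges of weight `0`.** -/
theorem HMFc_ext (o a₁ a₂ a₃ b : V) :
    HMFc p ends o a₁ a₂ a₃ b = HMFc (pR keep p) (endsR keep ends) o a₁ a₂ a₃ b := by
  unfold HMFc CovForm.marginC CovForm.DEF CovForm.EQo CovForm.EQ3 CovForm.EQ3o CovForm.Do massM2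
    deltaT CovForm.gap
  simp only [prob_ext p h0, Set.preimage_inter, preimage_avoidAll, preimage_connEvent,
    preimage_PDEvent, preimage_TEvent, Xhat_ext p ends h0]

omit [IsStrictOrderedRing R] in
/-- **(HMF) does not see the edges of weight `0`.** -/
theorem HMF_ext_iff (o a₁ a₂ a₃ b : V) :
    HMF p ends o a₁ a₂ a₃ b ↔ HMF (pR keep p) (endsR keep ends) o a₁ a₂ a₃ b := by
  unfold HMF
  rw [HMFc_ext p ends h0]

end HMF

end ZeroEdges

end Summit.Ventures.PercRepro2
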